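import Summits.BirchSwinnertonDyer.BirchSwinnertonDyer.Theorems.KolyvaginDepthDoorKNSupplyManinFrame
import Summits.BirchSwinnertonDyer.BirchSwinnertonDyer.Theorems.KolyvaginDepthDoorKNSupplyResidualStructureOfPrint
import Summits.BirchSwinnertonDyer.BirchSwinnertonDyer.Theorems.Rank1ResidualJetRingClassFields
import Summits.BirchSwinnertonDyer.Rank1Residual.X11b.BDPRouteManin
import Literature.NumberTheory.EllipticCurves.NonEisensteinPrimeOfSurjective
import HarnessLib

/-!
# Route `KolyvaginDepthDoor`, crux `KolyvaginDepthSupplyKN` (stmt-BirchSwinnertonDyer-22820) —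
# THE MOD-`p` STRUCTURE STATEMENT ON THE KODAIRA–NÉRON CELL FROM PRINT **BY NAME ONLY**: the frame with
# `p ∤ c_φ` comes from Mazur 1978 + the Néron mapping property, so NO bookkeeping input is left

Helper file of the lead prover of line `levelone` (kdd-p1 g13; `--supports stmt-BirchSwinnertonDyer-22820
--as helper`); it closes nothing and BSD is not proved by it.

Skeleton v8 reached «one open stub + print by name + ONE bookkeeping stub `stub_pOptimalFrame`» (a
`p`-optimal parametrisation datum, the input of the Burungale–Castella–Grossi–Skinner record, which the
tree cannot produce). This file removes the bookkeeping: with Castella–Sano 2026 Thm. 3 (split case;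
(manin) `p ∤ c_φ` instead of `p`-optimality; record
`CastellaSano2026_kolyvaginClass_selmerDivisibility_eq_padicValNat_tamagawaProduct`, p678349), the
Selmer-module form of Zanarella's Prop. 2.18 (`Zanarella2019_kolyvaginClass_one_ne_zero_of_not_selmerDivisible`,
p678349) and the Howard–Zanarella rigidity fact (p675362), the frame is any datum with `p ∤ Dt.c`, and
such a datum EXISTS by the tree theorem
`Summit.BirchSwinnertonDyer.Rank1Residual.X11b.exists_modularParametrizationData_not_dvd` modulo three
print facts BY NAME: modularity `exists_isNewformOf`, Mazur 1978 Cor. 4.1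
`mazur_not_dvd_maninConstant_of_odd`, and the Néron mapping property
`integral_neronScaling_of_isGloballyMinimal`.

* `exists_kolyvaginClass_one_selmerCard_of_maninPrint` — per `(E, p, K)` produced by the line
  (`p ≥ 5` good ordinary, `ρ̄` and the tower onto, Kodaira–Néron conjunct, `K` Heegner with `d_K` odd,
  `≠ −3, −4`, `p ∤ d_K`, `p` split, `(d_K, N) = 1`): a frame `(Dt, β, ι)`, `n ∈ Λ` and a datum with
  `c_1(n) ≠ 0` and `#Sel_p(E/ℚ) = p^{ν(n)+1} ∨ #Sel_p(E^{(d_K)}/ℚ) = p^{ν(n)+1}` — from SIX PRINT FACTS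
  BY NAME and nothing else.

CONDITIONAL on the named facts (all print); BSD is NOT proved by this.

References: [CastellaSano2026] Thm. 3; [Zanarella2019] Def. 2.17, Prop. 2.18, Cor. 2.12, 2.14;
[Howard2004] Thm. 1.4.2, Prop. 1.5.5, Lemma 1.6.4; [Mazur1978] Cor. 4.1; [JetchevSkinnerWan2017]
Rem. 43 (`p ∤ c_E` under (irr), `p² ∤ N`); [SilvermanATAEC1994] Cor. IV.9.2 (d); [Cox2013] §9.A.
-/

set_option linter.dupNamespace false

noncomputable section

open scoped Classical NumberField

namespace Summit.BirchSwinnertonDyer.BirchSwinnertonDyer.Theorems.KolyvaginDepthDoor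

open Literature.NumberTheory.EllipticCurves Literature.NumberTheory.EllipticCurves.ModularForms
  WeierstrassCurve IsDedekindDomain
open Summit.BirchSwinnertonDyer.BirchSwinnertonDyer.Theorems

/-- **The mod-`p` structure statement on the Kodaira–Néron cell from six print facts BY NAME
(Castella–Sano Thm. 3, Zanarella Prop. 2.18 (Selmer form), Howard–Zanarella rigidity, modularity,
Mazur 1978 Cor. 4.1, Néron scaling) — NO `p`-optimal frame, NO bookkeeping input.** For `E/ℚ`
globally minimal, `p ≥ 5` good ordinary with `ρ̄_{E,p}` and the tower onto and `p ∤ ord_v(Δ_min)` at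
every multiplicative place, `K` imaginary quadratic Heegner with `d_K` odd, `≠ −3, −4`, `(d_K, N) = 1`,
`p ∤ d_K`, `p` split in `K`: a frame `(Dt, β, ι)` (with `p ∤ Dt.c`), `n ∈ Λ` and a datum with
`c_1(n) ≠ 0` and `#Sel_p(E/ℚ) = p^{ν(n)+1} ∨ #Sel_p(E^{(d_K)}/ℚ) = p^{ν(n)+1}`. Proof: the datum with
`p ∤ c` is `Rank1Residual.X11b.exists_modularParametrizationData_not_dvd` (`p² ∤ N` since `p ∤ N` at a
good prime; `E[p]` irreducible from `ρ̄` onto); `p ∤ Tam_E` on the Kodaira–Néron cell; then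
`exists_minimal_kolyvaginClass_one_selmerCard_of_castellaSano`. CONDITIONAL on the named facts.
[cite: CastellaSano2026, Thm. 3 (arXiv:2601.14504 §1.1.6)] [cite: Zanarella2019, Prop. 2.18, Cor. 2.14]
[cite: Howard2004, Lemma 1.6.4] [cite: Mazur1978, Cor. 4.1] [cite: WZhang2014, Lemma 8.4 (1) (p. 236)] -/
theorem exists_kolyvaginClass_one_selmerCard_of_maninPrint
    (h3 : Literature.NumberTheory.EllipticCurves.CastellaSano2026_kolyvaginClass_selmerDivisibility_eq_padicValNat_tamagawaProduct)
    (hZ : Literature.NumberTheory.EllipticCurves.Zanarella2019_kolyvaginClass_one_ne_zero_of_not_selmerDivisible)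
    (hHZ : Literature.NumberTheory.EllipticCurves.HowardZanarella_exists_minimal_kolyvaginClass_one_selmerCard_of_ne_zero)
    (hnf : exists_isNewformOf) (hMaz : mazur_not_dvd_maninConstant_of_odd)
    (hNS : integral_neronScaling_of_isGloballyMinimal)
    (W : WeierstrassCurve ℚ) [W.IsElliptic] [W.IsGloballyMinimal] (p : ℕ) [hp : Fact p.Prime]
    (h5 : 5 ≤ p) (hgood : W.HasGoodReductionAtPrime p) (hord : ¬ (p : ℤ) ∣ W.frobeniusTrace p)
    (hsur : W.HasSurjectiveModNGaloisRep p) (htower : ∀ n : ℕ, W.HasSurjectiveModNGaloisRep (p ^ n : ℕ))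
    (hKN : ∀ v : HeightOneSpectrum (𝓞 ℚ), W.HasMultiplicativeReductionAt v →
      ¬ p ∣ W.ordMinimalDiscriminant v)
    (K : Type) [Field K] [NumberField K] (hK : IsImaginaryQuadratic K)
    [NeZero (W.conductorNorm ℤ)] (hHeeg : SatisfiesHeegnerHypothesis (W.conductorNorm ℤ) K)
    (hodd : Odd (NumberField.discr K)) (hD3 : NumberField.discr K ≠ -3) (hD4 : NumberField.discr K ≠ -4)
    (hDN : IsCoprime (NumberField.discr K) ((W.conductorNorm ℤ : ℕ) : ℤ))
    (hpD : ¬ ((p : ℤ) ∣ NumberField.discr K)) (hspl : SatisfiesHeegnerHypothesis p K) :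
    ∃ (Dt : ModularParametrizationData W (W.conductorNorm ℤ)) (β : ℤ) (ι : K →+* ℂ) (n : ℕ)
      (d : KolyvaginHeegnerData Dt β ι n),
      KolyvaginDescent.KolSupp (Zhang2014.IsKolyvaginPrime (W.conductorNorm ℤ) W K p) n ∧
        d.kolyvaginClass hp.out 1 ≠ 0 ∧
        (Nat.card (W.selmerGroup p) = p ^ (n.primeFactors.card + 1) ∨
          Nat.card ((W.quadraticTwist (NumberField.discr K : ℚ)).selmerGroup p) =
            p ^ (n.primeFactors.card + 1)) := by
  have hpP : p.Prime := hp.out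
  have hp2 : p ≠ 2 := by omega
  -- the frame: a datum with `p ∤ c` (Mazur + Néron scaling), the orientation, an embedding
  have hpN : ¬ p ^ 2 ∣ W.conductorNorm ℤ := fun h ↦
    not_dvd_conductorNorm_of_hasGoodReductionAtPrime W hgood (dvd_trans (dvd_pow_self p two_ne_zero) h)
  have hirr : W.HasIrreducibleModPGaloisRep p :=
    hasIrreducibleModPGaloisRep_of_hasSurjectiveModNGaloisRep W p hsur
  obtain ⟨Dt, hc⟩ := Summit.BirchSwinnertonDyer.Rank1Residual.X11b.exists_modularParametrizationData_not_dvd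
    hnf hMaz hNS W rfl hpP hp2 hpN hirr
  obtain ⟨β, hβ⟩ := exists_dvd_sq_sub_discr_holds (W.conductorNorm ℤ) K hK hHeeg
  obtain ⟨ι⟩ : Nonempty (K →+* ℂ) := inferInstance
  haveI : ∀ k : ℕ, NumberField (ringClassField K ι k) := fun k ↦
    Summit.BirchSwinnertonDyer.Rank1Residual.JET.numberField_ringClassField K hK ι k
  -- `p ∤ Tam_E` on the Kodaira–Néron cell
  have htam : ¬ p ∣ W.tamagawaProduct := not_dvd_tamagawaProduct_of_kodairaNeron W p h5 hKN
  obtain ⟨n, d, hsupp, hne, -, hdich⟩ :=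
    exists_minimal_kolyvaginClass_one_selmerCard_of_castellaSano h3 hZ hHZ W p h5 hgood hord hsur htower
      htam K hK hHeeg hodd hD3 hD4 hDN hpD hspl Dt hc β hβ ι
  refine ⟨Dt, β, ι, n, d, hsupp, hne, ?_⟩
  rcases hdich with ⟨h, -⟩ | ⟨h, -⟩
  · exact Or.inl h
  · exact Or.inr h

end Summit.BirchSwinnertonDyer.BirchSwinnertonDyer.Theorems.KolyvaginDepthDoor

end
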